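import Literature.Analysis.InnerProduct.LensSpaceIsospectralRigidityTwicePrimePower
import HarnessLib

/-!
# Ikeda–Yamamoto's Main Theorem for `q = 2^ν`: two isospectral three-dimensional lens spaces whose fundamental group has
# order a power of two are isometric (Ikeda–Yamamoto 1979, §9) — and the Main Theorem for all three families of the paper

Layer `Literature/Analysis/InnerProduct`, namespace `Literature.Analysis.InnerProduct`; lane `lit-hodgefound`, prover seat
`lit-hodgefound-p06`, generation 46, row g46-#1. THEOREMS only (no definition, no instance, no notation, no named fact).
Companion of `LensSpaceIsospectralRigidityPrimePower.lean` (row g45-#6: `q = l^ν`, the relation (7.5)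
`cot_pairSum_eq_of_lensMultiplicity_eq`), `LensSpaceIsospectralRigidityPrime.lean` (row g45-#2: Lemma 5.3 = the theorem of
Chowla–Okada of the tree in signed-indicator form, `sum_signedIndicator_eq_zero_of_sum_mul_cot_eq_zero`, valid for every
modulus `> 2`), `LensSpaceGeneratingFunctionDoublePoles.lean` (row g45-#3: Lemma 4.4 in divisor form) and
`LensSpaceIsospectralRigidityTwicePrimePower.lean` (row g45-#7: `q = 2l^ν`, `q ∣ 8`, Lemma 6.1). With this file the Main
Theorem of the 1979 paper is a tree theorem in exactly the generality proved there: `q = l^ν`, `2l^ν`, `2^ν`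
(`lensMultiplicity_eq_iff_lensWeightsEquivalent_of_prime_pow_or_twice_odd`).

## Source, verbatim (held text `paper:doi-10-18910-4811`)

A. Ikeda, Y. Yamamoto, *On the spectra of 3-dimensional lens spaces*, Osaka J. Math. **16** (1979) 447–469. Introduction
(p. 447–448): "**Main Theorem.** Let `q` be a positive integer. If two 3-dimensional lens spaces with fundamental group of
order `q` are isospectral to each other, then they are isometric to each other. This theorem will be shown here in this
paper only for `q = l^ν`, `2l^ν` and `2^ν` where `l` is an odd prime and `ν ≥ 1`. In case of any composite number `q`, the
second auther will give a proof in the forthcoming paper [14]." — §6 (p. 459): "**Lemma 6.1.** Main Theorem holds when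
`q ≤ 10`." — §9 (p. 464–468): "**9. Proof of Main Theorem for `q = 2^ν` (`ν ≥ 1`).** By Lemma 6.1, we may assume `ν ≥ 4`.
Since `q = 2^ν`, either `p₁ + 1` or `p₁ − 1` is divisible by `2²`. So that, by the same reason as in the preceding
sections, we may assume (9.1) `(p₁ + 1, q) = (p₂ + 1, q) = 2^μ` where [`ν > μ ≥ 2`]. First, assume `ν − μ = 1`. Then it is
easy to see that [`p₁ ≡ p₂ (mod q)`], which proves our assertion. Next, assume `ν − μ ≥ 2`. Substituting `k = 1` and
`k = 2^{ν−μ} − 1` (which satisfy (4.13) and (4.14)) in (4.18) and taking their sum, we obtain; (9.2)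
`−cot(π/q₀)(p₁−1)/2 − cot(π/q₀)(p₁−1)k/2 − cot(π/q₀)(p₁*−1)/2 − cot(π/q₀)(p₁*−1)k/2 = [the same for p₂]`, where
`k = 2^{ν−μ} − 1` and `q₀ = 2^{ν−1}`. **Lemma 9.1.** (i) If `p₁² ≡ 1 (mod q₀)`, then `p₁* ≡ p₁ + 2^{ν−1} (mod q)`. (ii) If
`p₁ ≡ p₂ (mod q₀)` and `p₁² ≡ 1 (mod q₀)`, then `p₁ ≡ p₂ (mod q)` or `p₁ ≡ p₂* (mod q)`. … **Lemma 9.2.** … We assume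
`p₁ ≢ p₂ (mod q)` and `p₁ ≢ p₂* (mod q)`. Applying Lemma 5.3 and Lemma 9.2 to (9.2), we see easily that only the following
cases are possible; Case A (9.11)–(9.14), Case B, Case C (9.15)–(9.18), Case D, and the cases where we interchange `p₂` and
`p₂*` with each other in the cases B, C and D. Here, we shall prove that, under our assumptions `p₁ ≢ p₂ (mod q)` and
`p₁ ≢ p₂* (mod q)`, the cases A, B, C and D do not occure. … [Case C: (9.28) `(k + 1)(k − 1) ≡ 0 (mod q₀)`. Since
`k + 1 = 2^{ν−μ}`, `k − 1 = 2^{ν−μ} − 2` and `μ ≥ 2`, we see (9.29) `μ = 2`. … (9.33) `p₂ + p₂* ≡ 2 (mod q₀)` … (9.35) …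
which contradicts `ν ≥ 4` … (9.37) `p₁ ≡ p₂*` which contradicts our assumption.] q.e.d." (The displayed congruences
(9.3)–(9.27), (9.30)–(9.32), (9.34), (9.36), (9.38)–(9.40) are not legible in the held scan; see "as formalised" below.)

## The proof, as formalised

`q = 2^ν`, `ν ≥ 4`, `q₀ = q/2 = 2^{ν−1}`, normalized isospectral pair `L(q; 1, p₁)`, `L(q; 1, p₂)` with `4 ∣ pᵢ + 1` (the
dyadic normalisation: all weights are odd, `p ↦ −p` is an isometry, and Lemma 4.4 with `d = 4` transports `4 ∣ p₁ + 1` to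
`4 ∣ p₂ ± 1`), `2^μ ∥ p₁ + 1` (so `2 ≤ μ < ν`; Lemma 4.4 with `d = 2^μ, 2^{μ+1}` gives `2^μ ∥ p₂ + 1`, and `pᵢ* + 1 ≡
pᵢ*(pᵢ + 1)` gives `2^μ ∥ pᵢ* + 1`) — this is (9.1). Halved weights `aᵢ = (pᵢ − 1)/2`, `bᵢ = (pᵢ* − 1)/2` (odd integers,
units of `ℤ/q₀`, with `aᵢ ≡ bᵢ ≡ 2^{μ−1} − 1 (mod 2^μ)`).
* §0–§1: the case `ν − μ = 1` is immediate (`pᵢ + 1 = 2^{ν−1}·odd`). For `ν − μ ≥ 2`, (9.2) IS the tree's relation (7.5)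
  (`cot_pairSum_eq_of_lensMultiplicity_eq`, row g45-#6, whose hypotheses (4.13)/(4.14) hold at `k = 1` and
  `k = K = 2^{ν−μ} − 1`, and `q ∣ (K + 1)(pᵢ + 1)`) with every argument halved, `cot(π·2s/2q₀) = cot(πs/q₀)`
  (`cot_two_mul_div_two_mul`); its eight arguments `aᵢ, Kaᵢ, bᵢ, Kbᵢ` are units of `ℤ/q₀`, so "applying Lemma 5.3" (row
  g45-#2's `sum_signedIndicator_eq_zero_of_sum_mul_cot_eq_zero` at the modulus `q₀ = 2^{ν−1} > 2`) gives the vanishing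
  signed indicator `∑_{s ∈ (a₁, Ka₁, b₁, Kb₁)} ([y = s] − [y = −s]) = ∑_{s ∈ (a₂, Ka₂, b₂, Kb₂)} ([y = s] − [y = −s])` on
  `ℤ/q₀` (`signedIndicator_pair_eq_of_lensMultiplicity_eq_two_mul`, stated for any `q = 2q₀`, `q₀ ≥ 3`).
* §2 (in place of Lemma 9.2 / Cases A–D, whose displayed congruences are illegible in the held scan — a documented shorter
  road to the same conclusion): since `2^{μ−1} ∣ aᵢ + 1`, in `ℤ/q₀` one has `K·X = −X − h` with `h = 2^{ν−μ}` for
  `X = aᵢ, bᵢ` (this is the content of "`k + 1 = 2^{ν−μ}`"), so the identity involves the sixteen points `±X`, `∓X ∓ h`.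
  Reduce modulo `2^μ ∣ q₀`: `X ↦ r = 2^{μ−1} − 1`, `−X ↦ −r`, `X + h ↦ r + h̄`, `−X − h ↦ −r − h̄` with `2r = −2 ≠ 0` and
  `2r + h̄ = 2^{ν−μ} − 2 ≠ 0 (mod 2^μ)`. Reading the identity at `y = a₁` (and, by its symmetry `a₁ ↔ b₁`, at `y = b₁`):
  if `h̄ ≠ 0` (i.e. `ν < 2μ`) only the base points share the class of `a₁` and `1 + [a₁ = b₁] = [a₁ = a₂] + [a₁ = b₂]`
  forces `a₁ ∈ {a₂, b₂}`; if `h̄ = 0`, `1 + [a₁ = b₁] − [a₁ = b₁ + h] = [a₁ = a₂] − [a₁ = a₂ + h] + [a₁ = b₂] − [a₁ = b₂ + h]`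
  forces `a₁ ∈ {a₂, b₂}` or `a₁ = b₁ + h` (`eq_or_eq_of_signedIndicator_pair_eq_dyadic`: `a₁ ∈ {a₂, b₂}` or
  `b₁ ∈ {a₂, b₂}` — i.e. `p₁ ≡ p₂` or `p₁ ≡ p₂* (mod q)`, as `aᵢ, bᵢ (mod q₀)` determine `pᵢ, pᵢ* (mod q)` — or the residual
  configuration `a₁ = b₁ + h ∧ b₁ = a₁ + h`).
* §3: the residual configuration forces `2h = 0`, i.e. `μ = 2` (the source's (9.29)), and `p₁* ≡ p₁ + 2^{ν−1} (mod 2^ν)`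
  (the source's Lemma 9.1 (i) shape); then `p₁p₁* ≡ 1` gives `p₁² + 2^{ν−1}p₁ ≡ 1 (mod 2^ν)`, impossible modulo `16` for
  `p₁ ≡ 3 (mod 8)` when `ν ≥ 5` ("which contradicts …"), while for `ν = 4` directly `p₁, p₂ ∈ {3, 11 = 3*} (mod 16)`
  (`dvd_of_lensMultiplicity_one_eq_of_two_pow_of_four_dvd`). THE MAIN THEOREM for `q = 2^ν`, normalized weights and every
  `ν` (`dvd_of_lensMultiplicity_one_eq_of_two_pow`: `ν ≤ 3` by Lemma 6.1 = row g45-#7's `dvd_of_lensMultiplicity_eq_of_dvd_eight`,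
  homogeneous weights by Corollary 3.4), general weights (`dvd_of_lensMultiplicity_eq_of_two_pow`, Proposition 1.1),
  ISOSPECTRAL ⟺ ISOMETRIC for `q = 2^ν` (`lensMultiplicity_eq_iff_lensWeightsEquivalent_of_two_pow`) and for all three
  families `q ∈ {l^ν, 2l^ν, 2^ν}` of the paper (`lensMultiplicity_eq_iff_lensWeightsEquivalent_of_prime_pow_or_twice_odd`).

## References

* [IkedaYamamoto1979] A. Ikeda, Y. Yamamoto, *On the spectra of 3-dimensional lens spaces*, Osaka J. Math. 16 (1979) 447–469:
  Main Theorem (`q = 2^ν`) and Introduction p. 447–448, §9 (9.1), (9.2), Lemma 9.1, Lemma 9.2, Cases A–D (p. 464–468),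
  Lemma 6.1, Lemma 4.4, Corollary 4.5, Corollary 4.7 (4.18), Lemma 5.3, Corollary 3.4, Proposition 4.1, Proposition 1.1.
* [Okada1981] T. Okada, *On an extension of a theorem of S. Chowla*, Acta Arith. 38 (1980/81) 341–345 (Lemma 5.3 for all `q`).
* [Ikeda1980] A. Ikeda, *On lens spaces which are isospectral but not isometric*, Ann. Sci. ÉNS (4) 13 (1980) 303–315,
  Theorem 2.1 (the isometry criterion `LensWeightsEquivalent`).
-/

noncomputable section

open Finset Filter Topology Complex

namespace Literature.Analysis.InnerProduct

open _root_.Real _root_.Filter _root_.Topology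

/-! ### §0 Periodicity and halving of the cotangent terms -/

/-- `cot(πt/q) = cot(πt̃/q)` with `t̃ ∈ [0, q)` the representative of `t mod q`. [folklore] -/
private theorem cot_intCast_eq_cot_val_dy {q : ℕ} [NeZero q] (t : ℤ) :
    Complex.cot (π * t / q) = Complex.cot (π * (((t : ZMod q).val : ℕ) : ℂ) / q) := by
  have hq : (q : ℂ) ≠ 0 := Nat.cast_ne_zero.mpr (NeZero.ne q)
  obtain ⟨m, hm⟩ : (q : ℤ) ∣ t - (((t : ZMod q).val : ℕ) : ℤ) := by
    rw [← ZMod.intCast_zmod_eq_zero_iff_dvd]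
    push_cast
    rw [ZMod.natCast_zmod_val, sub_self]
  have he : cexp (2 * π * I * t / q) = cexp (2 * π * I * ((((t : ZMod q).val : ℕ) : ℤ) : ℂ) / q) := by
    rw [Complex.exp_eq_exp_iff_exists_int]
    refine ⟨m, ?_⟩
    have ht : (t : ℂ) = ((((t : ZMod q).val : ℕ) : ℤ) : ℂ) + (q : ℂ) * (m : ℂ) := by
      exact_mod_cast (show t = (((t : ZMod q).val : ℕ) : ℤ) + q * m by linear_combination hm)
    rw [ht]
    field_simp
  have h1 := I_mul_cot_eq_ratio q t
  have h2 := I_mul_cot_eq_ratio q ((((t : ZMod q).val : ℕ) : ℤ))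
  rw [he] at h1
  push_cast at h1 h2
  exact mul_left_cancel₀ I_ne_zero (h1.trans h2.symm)

/-- **Halving**: `cot(π·2s/2q₀) = cot(π s̃/q₀)` — the passage from the modulus `q = 2q₀` of (4.18)/(7.5) to the modulus
`q₀ = 2^{ν−1}` of (9.2) ("`cot(π/q₀)(p₁−1)/2`", …). [cite: IkedaYamamoto1979, §9 (9.2)] -/
theorem cot_two_mul_div_two_mul {q₀ : ℕ} [NeZero q₀] (s : ℤ) :
    Complex.cot (π * ((2 * s : ℤ) : ℂ) / ((2 * q₀ : ℕ) : ℂ)) = Complex.cot (π * (((s : ZMod q₀).val : ℕ) : ℂ) / q₀) := by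
  have hq : (q₀ : ℂ) ≠ 0 := Nat.cast_ne_zero.mpr (NeZero.ne q₀)
  have e1 : (π : ℂ) * ((2 * s : ℤ) : ℂ) / ((2 * q₀ : ℕ) : ℂ) = π * (s : ℂ) / q₀ := by
    push_cast
    field_simp
  rw [e1]
  exact cot_intCast_eq_cot_val_dy s

/-! ### §1 The relation (9.2) and its signed-indicator form -/

/-- `pp* ≡ 1 (mod n)` read in `ℤ/n`. [folklore] -/
private theorem cast_mul_cast_eq_one_dy {n : ℕ} {p u : ℤ} (hu : (n : ℤ) ∣ u * p - 1) :
    (u : ZMod n) * (p : ZMod n) = 1 := by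
  have h := (ZMod.intCast_zmod_eq_zero_iff_dvd (u * p - 1) n).mpr hu
  push_cast at h
  exact sub_eq_zero.mp h

/-- The halved unit relation: `p = 2a + 1`, `p* = 2b + 1`, `pp* ≡ 1 (mod 2q₀)` give `b(2a + 1) = −a` in `ℤ/q₀`
(`(2b+1)(2a+1) − 1 = 2(2ab + a + b)`). [folklore] -/
private theorem halved_inv_rel_dy {q₀ : ℕ} {p u a b : ℤ} (ha : p = 2 * a + 1) (hb : u = 2 * b + 1)
    (hu : ((2 * q₀ : ℕ) : ℤ) ∣ u * p - 1) : (b : ZMod q₀) * (2 * (a : ZMod q₀) + 1) = -(a : ZMod q₀) := by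
  have hd : (q₀ : ℤ) ∣ 2 * a * b + a + b := by
    obtain ⟨c, hc⟩ := hu
    refine ⟨c, ?_⟩
    have : (2 : ℤ) * (2 * a * b + a + b) = 2 * (q₀ * c) := by
      rw [ha, hb] at hc; push_cast at hc; linear_combination hc
    linarith
  have h := (ZMod.intCast_zmod_eq_zero_iff_dvd _ q₀).mpr hd
  push_cast at h
  linear_combination h

/-- **The relation (9.2) and "applying Lemma 5.3" to it (Ikeda–Yamamoto 1979, §9), signed-indicator form.** Let `q = 2q₀`
with `q₀ ≥ 3`, let `L(q; 1, p₁)`, `L(q; 1, p₂)` be isospectral with odd weights `pᵢ = 2aᵢ + 1`, `pᵢ* = 2bᵢ + 1`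
(`pᵢpᵢ* ≡ 1 (mod q)`), `a₁, a₂` prime to `q₀`, `q ∤ p₁ + 1`, and let `K` be prime to `q` with `q ∣ (K + 1)(pᵢ + 1)`
(in the source `K = 2^{ν−μ} − 1`, `(pᵢ + 1, q) = 2^μ`, `q₀ = 2^{ν−1}`). Then the sum of (4.18) at `k = 1` and `k = K` is the
eight-term relation (7.5) in the `cot(π(pᵢ − 1)k/q)`, which HALVED reads (9.2):
`cot(πa₁/q₀) + cot(πKa₁/q₀) + cot(πb₁/q₀) + cot(πKb₁/q₀) = ` the same for `a₂, b₂` — eight units of `ℤ/q₀` — and Lemma 5.3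
(the theorem of Chowla–Okada of the tree, valid for every modulus `q₀ > 2`) turns it into the vanishing signed indicator: for
every `y ∈ ℤ/q₀`, `∑_{s ∈ (a₁, Ka₁, b₁, Kb₁)} ([y = s] − [y = −s]) = ∑_{s ∈ (a₂, Ka₂, b₂, Kb₂)} ([y = s] − [y = −s])`.
[cite: IkedaYamamoto1979, §9 (9.2), §7 (7.5), Corollary 4.7 (4.18), Lemma 5.3] [cite: Okada1981, Theorem] -/
theorem signedIndicator_pair_eq_of_lensMultiplicity_eq_two_mul {q q₀ : ℕ} [NeZero q] [NeZero q₀] (hq : q = 2 * q₀)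
    (hq₀ : 2 < q₀) {K p₁ u₁ p₂ u₂ a₁ b₁ a₂ b₂ : ℤ} (ha₁ : p₁ = 2 * a₁ + 1) (hb₁ : u₁ = 2 * b₁ + 1)
    (ha₂ : p₂ = 2 * a₂ + 1) (hb₂ : u₂ = 2 * b₂ + 1) (hu₁ : (q : ℤ) ∣ u₁ * p₁ - 1) (hu₂ : (q : ℤ) ∣ u₂ * p₂ - 1)
    (hca₁ : IsCoprime a₁ q₀) (hca₂ : IsCoprime a₂ q₀) (hK : IsCoprime K q) (hp₁ : ¬ (q : ℤ) ∣ p₁ + 1)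
    (hK₁ : (q : ℤ) ∣ (K + 1) * (p₁ + 1)) (hK₂ : (q : ℤ) ∣ (K + 1) * (p₂ + 1))
    (h : ∀ n : ℕ, lensMultiplicity q 1 p₁ n = lensMultiplicity q 1 p₂ n) (y : ZMod q₀) :
    ((if y = (a₁ : ZMod q₀) then (1 : ℤ) else 0) - (if y = -(a₁ : ZMod q₀) then 1 else 0)) +
        ((if y = (K : ZMod q₀) * (a₁ : ZMod q₀) then (1 : ℤ) else 0) -
          (if y = -((K : ZMod q₀) * (a₁ : ZMod q₀)) then 1 else 0)) +
        ((if y = (b₁ : ZMod q₀) then (1 : ℤ) else 0) - (if y = -(b₁ : ZMod q₀) then 1 else 0)) +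
        ((if y = (K : ZMod q₀) * (b₁ : ZMod q₀) then (1 : ℤ) else 0) -
          (if y = -((K : ZMod q₀) * (b₁ : ZMod q₀)) then 1 else 0)) =
      ((if y = (a₂ : ZMod q₀) then (1 : ℤ) else 0) - (if y = -(a₂ : ZMod q₀) then 1 else 0)) +
        ((if y = (K : ZMod q₀) * (a₂ : ZMod q₀) then (1 : ℤ) else 0) -
          (if y = -((K : ZMod q₀) * (a₂ : ZMod q₀)) then 1 else 0)) +
        ((if y = (b₂ : ZMod q₀) then (1 : ℤ) else 0) - (if y = -(b₂ : ZMod q₀) then 1 else 0)) +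
        ((if y = (K : ZMod q₀) * (b₂ : ZMod q₀) then (1 : ℤ) else 0) -
          (if y = -((K : ZMod q₀) * (b₂ : ZMod q₀)) then 1 else 0)) := by
  classical
  haveI : Nontrivial (ZMod q₀) := ZMod.nontrivial_iff.mpr (by omega)
  have hq0' : (1 : ℕ) < q₀ := by omega
  -- units of `ℤ/q₀`
  have unit_of : ∀ {t : ℤ}, IsCoprime t q₀ → IsUnit (t : ZMod q₀) := fun ht ↦
    (ZMod.coe_int_isUnit_iff_isCoprime _ _).mpr ht.symm
  have hKq₀ : IsCoprime K q₀ := by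
    apply IsCoprime.of_isCoprime_of_dvd_right hK
    rw [hq]; push_cast; exact dvd_mul_left _ _
  have hA : IsUnit (a₁ : ZMod q₀) := unit_of hca₁
  have hC : IsUnit (a₂ : ZMod q₀) := unit_of hca₂
  have hKu : IsUnit (K : ZMod q₀) := unit_of hKq₀
  have hu₁' : ((2 * q₀ : ℕ) : ℤ) ∣ u₁ * p₁ - 1 := by rw [← hq]; exact hu₁
  have hu₂' : ((2 * q₀ : ℕ) : ℤ) ∣ u₂ * p₂ - 1 := by rw [← hq]; exact hu₂
  have hrelB := halved_inv_rel_dy ha₁ hb₁ hu₁'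
  have hrelD := halved_inv_rel_dy ha₂ hb₂ hu₂'
  have hB : IsUnit (b₁ : ZMod q₀) := by
    have : IsUnit ((b₁ : ZMod q₀) * (2 * (a₁ : ZMod q₀) + 1)) := by rw [hrelB]; exact hA.neg
    exact isUnit_of_mul_isUnit_left this
  have hD : IsUnit (b₂ : ZMod q₀) := by
    have : IsUnit ((b₂ : ZMod q₀) * (2 * (a₂ : ZMod q₀) + 1)) := by rw [hrelD]; exact hC.neg
    exact isUnit_of_mul_isUnit_left this
  -- `2q₀ ∤ 2t` for `t` a unit mod `q₀`
  have ndvd_two_mul : ∀ {t : ℤ}, IsUnit (t : ZMod q₀) → ¬ (q : ℤ) ∣ 2 * t := by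
    intro t ht hd
    rw [hq] at hd
    push_cast at hd
    have hd' : (q₀ : ℤ) ∣ t := (mul_dvd_mul_iff_left two_ne_zero).mp hd
    exact ht.ne_zero ((ZMod.intCast_zmod_eq_zero_iff_dvd _ _).mpr hd')
  -- the hypotheses of (7.5) at the modulus `q`
  have h2 : ¬ (q : ℤ) ∣ 2 := by
    intro hd
    have := Int.le_of_dvd two_pos hd
    have : (q : ℤ) = 2 * q₀ := by rw [hq]; push_cast; ring
    omega
  have h2K : ¬ (q : ℤ) ∣ 2 * K := ndvd_two_mul hKu
  have hm₁ : ¬ (q : ℤ) ∣ p₁ - 1 := by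
    rw [show p₁ - 1 = 2 * a₁ by rw [ha₁]; ring]; exact ndvd_two_mul hA
  have hmK : ¬ (q : ℤ) ∣ K * (p₁ - 1) := by
    rw [show K * (p₁ - 1) = 2 * (K * a₁) by rw [ha₁]; ring]
    exact ndvd_two_mul (by push_cast; exact hKu.mul hA)
  have hpK : ¬ (q : ℤ) ∣ K * (p₁ + 1) := fun hd ↦ hp₁ (hK.symm.dvd_of_dvd_mul_left hd)
  have hrel := cot_pairSum_eq_of_lensMultiplicity_eq hu₁ hu₂ h2 h2K hm₁ hp₁ hmK hpK hK₁ hK₂ h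
  -- halve: `pᵢ − 1 = 2aᵢ`, `pᵢ* − 1 = 2bᵢ`
  have e2 : K * (p₁ - 1) = 2 * (K * a₁) := by rw [ha₁]; ring
  have e1 : p₁ - 1 = 2 * a₁ := by rw [ha₁]; ring
  have e4 : K * (u₁ - 1) = 2 * (K * b₁) := by rw [hb₁]; ring
  have e3 : u₁ - 1 = 2 * b₁ := by rw [hb₁]; ring
  have e6 : K * (p₂ - 1) = 2 * (K * a₂) := by rw [ha₂]; ring
  have e5 : p₂ - 1 = 2 * a₂ := by rw [ha₂]; ring
  have e8 : K * (u₂ - 1) = 2 * (K * b₂) := by rw [hb₂]; ring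
  have e7 : u₂ - 1 = 2 * b₂ := by rw [hb₂]; ring
  rw [e2, e1, e4, e3, e6, e5, e8, e7] at hrel
  subst hq
  simp only [cot_two_mul_div_two_mul] at hrel
  have c2 : ((K * a₁ : ℤ) : ZMod q₀) = (K : ZMod q₀) * (a₁ : ZMod q₀) := by push_cast; ring
  have c4 : ((K * b₁ : ℤ) : ZMod q₀) = (K : ZMod q₀) * (b₁ : ZMod q₀) := by push_cast; ring
  have c6 : ((K * a₂ : ℤ) : ZMod q₀) = (K : ZMod q₀) * (a₂ : ZMod q₀) := by push_cast; ring
  have c8 : ((K * b₂ : ℤ) : ZMod q₀) = (K : ZMod q₀) * (b₂ : ZMod q₀) := by push_cast; ring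
  rw [c2, c4, c6, c8] at hrel
  -- Lemma 5.3 for the eight signed unit points of (9.2)
  have hKa := hKu.mul hA
  have hKb := hKu.mul hB
  have hKc := hKu.mul hC
  have hKd := hKu.mul hD
  have hind := sum_signedIndicator_eq_zero_of_sum_mul_cot_eq_zero hq₀
    ![(a₁ : ZMod q₀), (K : ZMod q₀) * (a₁ : ZMod q₀), (b₁ : ZMod q₀), (K : ZMod q₀) * (b₁ : ZMod q₀),
      (a₂ : ZMod q₀), (K : ZMod q₀) * (a₂ : ZMod q₀), (b₂ : ZMod q₀), (K : ZMod q₀) * (b₂ : ZMod q₀)]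
    (by intro i; fin_cases i <;> assumption)
    ![1, 1, 1, 1, -1, -1, -1, -1]
    (by simp only [Fin.sum_univ_eight, Matrix.cons_val]; push_cast; linear_combination hrel) y
  rw [Fin.sum_univ_eight] at hind
  -- read the vector entries definitionally (keeps the `Decidable` instances those of the statement)
  have hind' : (1 : ℤ) * ((if y = (a₁ : ZMod q₀) then (1 : ℤ) else 0) - (if y = -(a₁ : ZMod q₀) then 1 else 0)) +
      1 * ((if y = (K : ZMod q₀) * (a₁ : ZMod q₀) then (1 : ℤ) else 0) -
        (if y = -((K : ZMod q₀) * (a₁ : ZMod q₀)) then 1 else 0)) +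
      1 * ((if y = (b₁ : ZMod q₀) then (1 : ℤ) else 0) - (if y = -(b₁ : ZMod q₀) then 1 else 0)) +
      1 * ((if y = (K : ZMod q₀) * (b₁ : ZMod q₀) then (1 : ℤ) else 0) -
        (if y = -((K : ZMod q₀) * (b₁ : ZMod q₀)) then 1 else 0)) +
      (-1) * ((if y = (a₂ : ZMod q₀) then (1 : ℤ) else 0) - (if y = -(a₂ : ZMod q₀) then 1 else 0)) +
      (-1) * ((if y = (K : ZMod q₀) * (a₂ : ZMod q₀) then (1 : ℤ) else 0) -
        (if y = -((K : ZMod q₀) * (a₂ : ZMod q₀)) then 1 else 0)) +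
      (-1) * ((if y = (b₂ : ZMod q₀) then (1 : ℤ) else 0) - (if y = -(b₂ : ZMod q₀) then 1 else 0)) +
      (-1) * ((if y = (K : ZMod q₀) * (b₂ : ZMod q₀) then (1 : ℤ) else 0) -
        (if y = -((K : ZMod q₀) * (b₂ : ZMod q₀)) then 1 else 0)) = 0 := hind
  linear_combination hind'

/-! ### §2 The combinatorics of §9, read modulo `2^μ` -/

/-- The signed-indicator identity of (9.2) read at the point `y = A`, modulo `M = 2^μ`. In `ℤ/q₀` let `A, B` / `C, D` be the
two sides' base points and `h` the shift (`KX = −X − h` for `X = A, B, C, D`), and let `φ : ℤ/q₀ → ℤ/M` (`M ∣ q₀`) take the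
same value `r` on `A, B, C, D`, with `2r ≠ 0`, `2r + φ(h) ≠ 0`, `h ≠ 0`. Then `A = C`, or `A = D`, or `φ(h) = 0` and
`A = B + h`: the points `−X`, `−X − h` (and `X + h` when `φ(h) ≠ 0`) lie in other classes than `A`, so the identity at
`y = A` reads `1 + [A = B] = [A = C] + [A = D]` (resp. `1 + [A = B] − [A = B + h] = [A = C] − [A = C + h] + [A = D] − [A = D + h]`).
[cite: IkedaYamamoto1979, §9 (9.2), Lemma 9.2, Cases A–D] -/
private theorem at_basePoint_dy {q₀ M : ℕ} [NeZero q₀] (hM : M ∣ q₀) {A B C D h : ZMod q₀} {r : ZMod M}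
    (hA : ZMod.castHom hM (ZMod M) A = r) (hB : ZMod.castHom hM (ZMod M) B = r)
    (hC : ZMod.castHom hM (ZMod M) C = r) (hD : ZMod.castHom hM (ZMod M) D = r) (hr : r + r ≠ 0)
    (hrh : r + r + ZMod.castHom hM (ZMod M) h ≠ 0) (hh : h ≠ 0)
    (hind : ∀ y : ZMod q₀,
        ((if y = A then (1 : ℤ) else 0) - (if y = -A then 1 else 0)) +
          ((if y = -A - h then (1 : ℤ) else 0) - (if y = A + h then 1 else 0)) +
          ((if y = B then (1 : ℤ) else 0) - (if y = -B then 1 else 0)) +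
          ((if y = -B - h then (1 : ℤ) else 0) - (if y = B + h then 1 else 0)) =
        ((if y = C then (1 : ℤ) else 0) - (if y = -C then 1 else 0)) +
          ((if y = -C - h then (1 : ℤ) else 0) - (if y = C + h then 1 else 0)) +
          ((if y = D then (1 : ℤ) else 0) - (if y = -D then 1 else 0)) +
          ((if y = -D - h then (1 : ℤ) else 0) - (if y = D + h then 1 else 0))) :
    A = C ∨ A = D ∨ (ZMod.castHom hM (ZMod M) h = 0 ∧ A = B + h) := by
  set φ := ZMod.castHom hM (ZMod M) with hφ
  have cls : ∀ {x y : ZMod q₀}, φ x ≠ φ y → x ≠ y := fun hne e ↦ hne (by rw [e])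
  have hr' : r ≠ -r := fun e ↦ hr (by linear_combination e)
  have nX : ∀ {X : ZMod q₀}, φ X = r → A ≠ -X := fun hX ↦ cls (by rw [map_neg, hX, hA]; exact hr')
  have nXh : ∀ {X : ZMod q₀}, φ X = r → A ≠ -X - h := fun hX ↦ cls (by
    rw [map_sub, map_neg, hX, hA]; intro e; exact hrh (by linear_combination e))
  have nAh : A ≠ A + h := fun e ↦ hh (by linear_combination -e)
  by_cases hAC : A = C
  · exact Or.inl hAC
  by_cases hAD : A = D
  · exact Or.inr (Or.inl hAD)
  refine Or.inr (Or.inr ?_)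
  have hy := hind A
  rw [if_pos rfl, if_neg (nX hA), if_neg (nXh hA), if_neg nAh, if_neg (nX hB), if_neg (nXh hB), if_neg hAC,
    if_neg (nX hC), if_neg (nXh hC), if_neg hAD, if_neg (nX hD), if_neg (nXh hD)] at hy
  by_cases hφh : φ h = 0
  · refine ⟨hφh, ?_⟩
    by_contra hne
    rw [if_neg hne] at hy
    split_ifs at hy <;> omega
  · exfalso
    have nXph : ∀ {X : ZMod q₀}, φ X = r → A ≠ X + h := fun hX ↦ cls (by
      rw [map_add, hX, hA]; intro e; exact hφh (by linear_combination -e))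
    rw [if_neg (nXph hB), if_neg (nXph hC), if_neg (nXph hD)] at hy
    split_ifs at hy <;> omega

/-- **§9 — the combinatorial conclusion, modulo `2^μ`.** In `ℤ/q₀` let the base points `A, B` (one side), `C, D` (other side)
and the shift `h ≠ 0` of the signed-indicator identity of (9.2) — written with `KX = −X − h` — have a common image `r` under
the reduction `φ : ℤ/q₀ → ℤ/M` (`M ∣ q₀`; in the source `M = 2^μ`, `r = 2^{μ−1} − 1`, `φ(h) = 2^{ν−μ}`), with `2r ≠ 0` and
`2r + φ(h) ≠ 0`. Then `A ∈ {C, D}` or `B ∈ {C, D}` ("`p₁ ≡ p₂` or `p₁ ≡ p₂*`"), or else `A = B + h` and `B = A + h` (the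
residual configuration, possible only when `2h = 0`): `at_basePoint_dy` at `y = A` and, by the symmetry `A ↔ B` of the
identity, at `y = B`. This replaces the case list Lemma 9.2 / Cases A–D ((9.11)–(9.40)) of the source.
[cite: IkedaYamamoto1979, §9 (9.2), Lemma 9.2, Cases A–D] -/
theorem eq_or_eq_of_signedIndicator_pair_eq_dyadic {q₀ M : ℕ} [NeZero q₀] (hM : M ∣ q₀) {A B C D h : ZMod q₀}
    {r : ZMod M} (hA : ZMod.castHom hM (ZMod M) A = r) (hB : ZMod.castHom hM (ZMod M) B = r)
    (hC : ZMod.castHom hM (ZMod M) C = r) (hD : ZMod.castHom hM (ZMod M) D = r) (hr : r + r ≠ 0)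
    (hrh : r + r + ZMod.castHom hM (ZMod M) h ≠ 0) (hh : h ≠ 0)
    (hind : ∀ y : ZMod q₀,
        ((if y = A then (1 : ℤ) else 0) - (if y = -A then 1 else 0)) +
          ((if y = -A - h then (1 : ℤ) else 0) - (if y = A + h then 1 else 0)) +
          ((if y = B then (1 : ℤ) else 0) - (if y = -B then 1 else 0)) +
          ((if y = -B - h then (1 : ℤ) else 0) - (if y = B + h then 1 else 0)) =
        ((if y = C then (1 : ℤ) else 0) - (if y = -C then 1 else 0)) +
          ((if y = -C - h then (1 : ℤ) else 0) - (if y = C + h then 1 else 0)) +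
          ((if y = D then (1 : ℤ) else 0) - (if y = -D then 1 else 0)) +
          ((if y = -D - h then (1 : ℤ) else 0) - (if y = D + h then 1 else 0))) :
    A = C ∨ A = D ∨ B = C ∨ B = D ∨ (A = B + h ∧ B = A + h) := by
  have k1 := at_basePoint_dy hM hA hB hC hD hr hrh hh hind
  have k2 := at_basePoint_dy hM (A := B) (B := A) (C := C) (D := D) hB hA hC hD hr hrh hh
    (fun y ↦ by have := hind y; linarith)
  tauto

/-! ### §3 THE MAIN THEOREM for `q = 2^ν` (Ikeda–Yamamoto 1979, §9) -/

/-- An odd integer is prime to every power of two. [folklore] -/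
private theorem isCoprime_two_pow_of_odd_dy {t : ℤ} (ht : Odd t) (n : ℕ) : IsCoprime t ((2 ^ n : ℕ) : ℤ) := by
  obtain ⟨c, rfl⟩ := ht
  have h2 : IsCoprime (2 * c + 1) (2 : ℤ) := ⟨1, -c, by ring⟩
  have h2n : IsCoprime (2 * c + 1) ((2 : ℤ) ^ n) := h2.pow_right
  exact_mod_cast h2n

/-- `x ≡ 2^{m+1} − 1 (mod 2^{m+2})` when `2^{m+1} ∥ x + 1`. [folklore] -/
private theorem intCast_eq_of_pow_dvd_dy {m : ℕ} {x : ℤ} (h1 : (2 : ℤ) ^ (m + 1) ∣ x + 1)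
    (h2 : ¬ (2 : ℤ) ^ (m + 2) ∣ x + 1) :
    (x : ZMod (2 ^ (m + 2))) = (((2 : ℤ) ^ (m + 1) - 1 : ℤ) : ZMod (2 ^ (m + 2))) := by
  obtain ⟨s, hs⟩ := h1
  obtain ⟨w, hw⟩ : Odd s := by
    rw [← Int.not_even_iff_odd]
    rintro ⟨w, rfl⟩
    exact h2 ⟨w, by rw [hs]; ring⟩
  rw [ZMod.intCast_eq_intCast_iff_dvd_sub]
  push_cast
  rw [hw] at hs
  exact ⟨-w, by linear_combination -hs⟩

/-- `q = 16`, both weights `≡ 3 (mod 8)`: `p₁ ≡ p₂` or `p₁p₂ ≡ 1 (mod 16)` (`{3, 11} = {3, 3*}`). [folklore] -/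
private theorem sixteen_dvd_dy {p₁ p₂ c₁ c₂ : ℤ} (hc₁ : p₁ + 1 = 4 * c₁) (hc₂ : p₂ + 1 = 4 * c₂) (ho₁ : Odd c₁)
    (ho₂ : Odd c₂) : (16 : ℤ) ∣ p₁ - p₂ ∨ (16 : ℤ) ∣ p₁ * p₂ - 1 := by
  obtain ⟨i, hi⟩ := ho₁
  obtain ⟨j, hj⟩ := ho₂
  rcases Int.even_or_odd (i - j) with ⟨w, hw⟩ | ⟨w, hw⟩
  · exact Or.inl ⟨w, by linear_combination hc₁ - hc₂ + 4 * hi - 4 * hj + 8 * hw⟩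
  · refine Or.inr ⟨4 * i * j + 3 * (j + w) + 2, ?_⟩
    have hp₁ : p₁ = 8 * i + 3 := by linear_combination hc₁ + 4 * hi
    have hp₂ : p₂ = 8 * j + 3 := by linear_combination hc₂ + 4 * hj
    have hij : i = j + 2 * w + 1 := by linear_combination hw
    rw [hp₁, hp₂, hij]
    ring

/-- **§9 — THE MAIN THEOREM (Ikeda–Yamamoto 1979) for `q = 2^ν`, `ν ≥ 4`, normalized weights with `4 ∣ pᵢ + 1`.** Let
`L(q; 1, p₁)`, `L(q; 1, p₂)` be isospectral, `pᵢpᵢ* ≡ 1 (mod q)`, `4 ∣ p₁ + 1`, `4 ∣ p₂ + 1`, `q ∤ p₁ + 1`. Then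
`p₁ ≡ p₂` or `p₁p₂ ≡ 1 (mod q)`. With `2^μ = (p₁ + 1, q)` ("(9.1)": Lemma 4.4 gives `(p₂ + 1, q) = 2^μ` as well, and the
same for `pᵢ*`): if `ν − μ = 1` then `pᵢ + 1 ≡ 2^{ν−1}` and `p₁ ≡ p₂ (mod q)`; if `ν − μ ≥ 2`, the relation (9.2) (`k = 1`
and `k = 2^{ν−μ} − 1` in (4.18), summed and halved to the modulus `q₀ = 2^{ν−1}`) and Lemma 5.3 give the signed-indicator
identity for `aᵢ = (pᵢ − 1)/2`, `bᵢ = (pᵢ* − 1)/2`, in which `K·X = −X − 2^{ν−μ}`; reading it modulo `2^μ`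
(`eq_or_eq_of_signedIndicator_pair_eq_dyadic`, in place of the source's Lemma 9.2 and Cases A–D) leaves `p₁ ≡ p₂`,
`p₁ ≡ p₂*`, or the residual configuration `p₁* ≡ p₁ + 2^{ν−1}` with `μ = 2`, which `p₁p₁* ≡ 1` read modulo `16`
excludes unless `ν = 4`, where `p₁, p₂ ∈ {3, 11 = 3*} (mod 16)`. [cite: IkedaYamamoto1979, Main Theorem (`q = 2^ν`), §9
(9.1), (9.2), Lemma 9.1, Lemma 9.2, Cases A–D, Lemma 4.4, Corollary 4.7, Lemma 5.3] -/
theorem dvd_of_lensMultiplicity_one_eq_of_two_pow_of_four_dvd {q ν : ℕ} (hq : q = 2 ^ ν) (hν : 4 ≤ ν)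
    {p₁ u₁ p₂ u₂ : ℤ} (hu₁ : (q : ℤ) ∣ u₁ * p₁ - 1) (hu₂ : (q : ℤ) ∣ u₂ * p₂ - 1) (h4₁ : (4 : ℤ) ∣ p₁ + 1)
    (h4₂ : (4 : ℤ) ∣ p₂ + 1) (hq₁ : ¬ (q : ℤ) ∣ p₁ + 1)
    (h : ∀ n : ℕ, lensMultiplicity q 1 p₁ n = lensMultiplicity q 1 p₂ n) :
    (q : ℤ) ∣ p₁ - p₂ ∨ (q : ℤ) ∣ p₁ * p₂ - 1 := by
  have hq0 : q ≠ 0 := by rw [hq]; positivity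
  haveI : NeZero q := ⟨hq0⟩
  have hqz : (q : ℤ) = 2 ^ ν := by rw [hq]; push_cast; ring
  -- Lemma 4.4 in divisor form, in both directions
  have h44 : ∀ {d : ℤ}, d ∣ (q : ℤ) → ¬ d ∣ 2 → (d ∣ p₁ + 1 ∨ d ∣ p₁ - 1) → d ∣ p₂ + 1 ∨ d ∣ p₂ - 1 :=
    fun hd hd2 hdp ↦ dvd_or_dvd_of_dvd_of_lensMultiplicity_eq hu₁ hu₂ h hd hd2 hdp
  have h44' : ∀ {d : ℤ}, d ∣ (q : ℤ) → ¬ d ∣ 2 → (d ∣ p₂ + 1 ∨ d ∣ p₂ - 1) → d ∣ p₁ + 1 ∨ d ∣ p₁ - 1 :=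
    fun hd hd2 hdp ↦ dvd_or_dvd_of_dvd_of_lensMultiplicity_eq hu₂ hu₁ (fun n ↦ (h n).symm) hd hd2 hdp
  have pow_dvd_q : ∀ {j : ℕ}, j ≤ ν → (2 : ℤ) ^ j ∣ (q : ℤ) := fun hj ↦ by rw [hqz]; exact pow_dvd_pow 2 hj
  have four_dvd_pow : ∀ {j : ℕ}, 2 ≤ j → (4 : ℤ) ∣ 2 ^ j := fun hj ↦ by
    rw [show (4 : ℤ) = 2 ^ 2 by norm_num]; exact pow_dvd_pow 2 hj
  have pow_not_dvd_two : ∀ {j : ℕ}, 2 ≤ j → ¬ (2 : ℤ) ^ j ∣ 2 := fun hj hd ↦ by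
    have h42 : (4 : ℤ) ∣ 2 := (four_dvd_pow hj).trans hd
    omega
  have n4 : ∀ {x : ℤ}, (4 : ℤ) ∣ x + 1 → ¬ (4 : ℤ) ∣ x - 1 := by intro x h1 h2; omega
  -- `2^μ ∥ p₁ + 1`, `2 ≤ μ < ν` ("(9.1)")
  have hp10 : p₁ + 1 ≠ 0 := fun h0 ↦ hq₁ (by rw [h0]; exact dvd_zero _)
  obtain ⟨μ, hμd, hμn⟩ : ∃ μ : ℕ, (2 : ℤ) ^ μ ∣ p₁ + 1 ∧ ¬ (2 : ℤ) ^ (μ + 1) ∣ p₁ + 1 := by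
    refine ⟨padicValInt 2 (p₁ + 1), by exact_mod_cast padicValInt_dvd (p := 2) (p₁ + 1), fun hd ↦ ?_⟩
    have := (padicValInt_dvd_iff (p := 2) _ (p₁ + 1)).mp (by exact_mod_cast hd)
    omega
  have h2μ : 2 ≤ μ := by
    by_contra hlt
    exact hμn ((pow_dvd_pow 2 (by omega : μ + 1 ≤ 2)).trans
      ((show (2 : ℤ) ^ 2 = 4 by norm_num) ▸ h4₁))
  have hμν : μ < ν := by
    by_contra hle
    exact hq₁ (by rw [hqz]; exact (pow_dvd_pow 2 (by omega : ν ≤ μ)).trans hμd)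
  -- the same exact power of two in `p₂ + 1`, `p₁* + 1`, `p₂* + 1`
  have hμd₂ : (2 : ℤ) ^ μ ∣ p₂ + 1 := by
    rcases h44 (pow_dvd_q hμν.le) (pow_not_dvd_two h2μ) (Or.inl hμd) with hd | hd
    · exact hd
    · exact absurd ((four_dvd_pow h2μ).trans hd) (n4 h4₂)
  have hμn₂ : ¬ (2 : ℤ) ^ (μ + 1) ∣ p₂ + 1 := by
    intro hd
    rcases h44' (pow_dvd_q (Nat.succ_le_of_lt hμν)) (pow_not_dvd_two (by omega)) (Or.inl hd) with hd' | hd'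
    · exact hμn hd'
    · exact n4 h4₁ ((four_dvd_pow (by omega)).trans hd')
  have hud : ∀ {p u : ℤ}, (q : ℤ) ∣ u * p - 1 → (2 : ℤ) ^ μ ∣ p + 1 → (2 : ℤ) ^ μ ∣ u + 1 := by
    intro p u hu hp
    rw [show u + 1 = u * (p + 1) - (u * p - 1) by ring]
    exact dvd_sub (dvd_mul_of_dvd_right hp u) ((pow_dvd_q hμν.le).trans hu)
  have hun : ∀ {p u : ℤ}, (q : ℤ) ∣ u * p - 1 → ¬ (2 : ℤ) ^ (μ + 1) ∣ p + 1 → ¬ (2 : ℤ) ^ (μ + 1) ∣ u + 1 := by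
    intro p u hu hp hd
    apply hp
    have h1 : (2 : ℤ) ^ (μ + 1) ∣ p * (u + 1) - (u * p - 1) :=
      dvd_sub (dvd_mul_of_dvd_right hd p) ((pow_dvd_q (Nat.succ_le_of_lt hμν)).trans hu)
    rwa [show p * (u + 1) - (u * p - 1) = p + 1 by ring] at h1
  by_cases hνμ : ν = μ + 1
  · -- `ν − μ = 1`: `pᵢ + 1 = 2^{ν−1}·odd`, `p₁ ≡ p₂ (mod q)`
    left
    obtain ⟨s, hs⟩ := hμd
    obtain ⟨s', hs'⟩ := hμd₂
    have hso : Odd s := by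
      rw [← Int.not_even_iff_odd]; rintro ⟨w, rfl⟩; exact hμn ⟨w, by rw [hs]; ring⟩
    have hso' : Odd s' := by
      rw [← Int.not_even_iff_odd]; rintro ⟨w, rfl⟩; exact hμn₂ ⟨w, by rw [hs']; ring⟩
    obtain ⟨w, hw⟩ : Even (s - s') := Odd.sub_odd hso hso'
    rw [hqz, hνμ]
    exact ⟨w, by linear_combination hs - hs' + 2 ^ μ * hw⟩
  -- `ν − μ ≥ 2`: write `μ = m + 2`, `ν = m + t + 4`, `q₀ = 2^{m+t+3}`, `h = 2^{ν−μ} = 2^{t+2}`, `K = h − 1`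
  obtain ⟨m, rfl⟩ : ∃ m, μ = m + 2 := ⟨μ - 2, by omega⟩
  obtain ⟨t, rfl⟩ : ∃ t, ν = m + t + 4 := ⟨ν - m - 4, by omega⟩
  subst hq
  haveI : NeZero (2 ^ (m + t + 3)) := ⟨by positivity⟩
  have hq' : 2 ^ (m + t + 4) = 2 * 2 ^ (m + t + 3) := by ring
  have hq₀ : 2 < 2 ^ (m + t + 3) := by
    have : 2 ^ 3 ≤ 2 ^ (m + t + 3) := Nat.pow_le_pow_right (by norm_num) (by omega)
    omega
  -- the halved weights `aᵢ = (pᵢ − 1)/2`, `bᵢ = (pᵢ* − 1)/2`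
  have base : ∀ {x : ℤ}, (2 : ℤ) ^ (m + 2) ∣ x + 1 → ¬ (2 : ℤ) ^ (m + 2 + 1) ∣ x + 1 →
      ∃ a : ℤ, x = 2 * a + 1 ∧ (2 : ℤ) ^ (m + 1) ∣ a + 1 ∧ ¬ (2 : ℤ) ^ (m + 2) ∣ a + 1 := by
    intro x hx hxn
    obtain ⟨s, hs⟩ := hx
    refine ⟨2 ^ (m + 1) * s - 1, by linear_combination hs, ⟨s, by ring⟩, fun hd ↦ hxn ?_⟩
    rw [show x + 1 = 2 * (2 ^ (m + 1) * s - 1 + 1) by linear_combination hs, pow_succ' 2 (m + 2)]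
    exact mul_dvd_mul_left 2 hd
  obtain ⟨a₁, ha₁, ha₁d, ha₁n⟩ := base hμd hμn
  obtain ⟨a₂, ha₂, ha₂d, ha₂n⟩ := base hμd₂ hμn₂
  obtain ⟨b₁, hb₁, hb₁d, hb₁n⟩ := base (hud hu₁ hμd) (hun hu₁ hμn)
  obtain ⟨b₂, hb₂, hb₂d, hb₂n⟩ := base (hud hu₂ hμd₂) (hun hu₂ hμn₂)
  have odd_of : ∀ {a : ℤ}, (2 : ℤ) ^ (m + 1) ∣ a + 1 → Odd a := by
    intro a ha
    obtain ⟨s, hs⟩ := (dvd_pow_self (2 : ℤ) (by omega : m + 1 ≠ 0)).trans ha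
    exact ⟨s - 1, by linear_combination hs⟩
  obtain ⟨K, hKd⟩ : ∃ K : ℤ, K = 2 ^ (t + 2) - 1 := ⟨_, rfl⟩
  have hKo : Odd K := ⟨2 ^ (t + 1) - 1, by rw [hKd]; ring⟩
  have hK : IsCoprime K ((2 ^ (m + t + 4) : ℕ) : ℤ) := isCoprime_two_pow_of_odd_dy hKo _
  have hKp : ∀ {x : ℤ}, (2 : ℤ) ^ (m + 2) ∣ x + 1 → ((2 ^ (m + t + 4) : ℕ) : ℤ) ∣ (K + 1) * (x + 1) := by
    intro x hx
    obtain ⟨s, hs⟩ := hx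
    exact ⟨s, by rw [hs, hKd]; push_cast; ring⟩
  -- (9.2) and Lemma 5.3
  have hind := signedIndicator_pair_eq_of_lensMultiplicity_eq_two_mul hq' hq₀ ha₁ hb₁ ha₂ hb₂ hu₁ hu₂
    (isCoprime_two_pow_of_odd_dy (odd_of ha₁d) _) (isCoprime_two_pow_of_odd_dy (odd_of ha₂d) _) hK hq₁
    (hKp hμd) (hKp hμd₂) h
  -- `K·X = −X − h` in `ℤ/q₀`
  have eK : ∀ {x : ℤ}, (2 : ℤ) ^ (m + 1) ∣ x + 1 →
      (K : ZMod (2 ^ (m + t + 3))) * (x : ZMod (2 ^ (m + t + 3))) =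
          -(x : ZMod (2 ^ (m + t + 3))) - (((2 : ℤ) ^ (t + 2) : ℤ) : ZMod (2 ^ (m + t + 3))) ∧
        -((K : ZMod (2 ^ (m + t + 3))) * (x : ZMod (2 ^ (m + t + 3)))) =
          (x : ZMod (2 ^ (m + t + 3))) + (((2 : ℤ) ^ (t + 2) : ℤ) : ZMod (2 ^ (m + t + 3))) := by
    intro x hx
    obtain ⟨s, hs⟩ := hx
    have z : (((2 : ℤ) ^ (t + 2) * (x + 1) : ℤ) : ZMod (2 ^ (m + t + 3))) = 0 :=
      (ZMod.intCast_zmod_eq_zero_iff_dvd _ _).mpr ⟨s, by rw [hs]; push_cast; ring⟩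
    rw [hKd]
    push_cast at z ⊢
    exact ⟨by linear_combination z, by linear_combination -z⟩
  obtain ⟨eA, eA'⟩ := eK ha₁d
  obtain ⟨eB, eB'⟩ := eK hb₁d
  obtain ⟨eC, eC'⟩ := eK ha₂d
  obtain ⟨eD, eD'⟩ := eK hb₂d
  have hind' := fun y ↦ by
    have := hind y
    rw [eA', eA, eB', eB, eC', eC, eD', eD] at this
    exact this
  -- reduction modulo `2^μ = 2^{m+2}`
  have hM : 2 ^ (m + 2) ∣ 2 ^ (m + t + 3) := Nat.pow_dvd_pow 2 (by omega)
  have cls : ∀ {a : ℤ}, (2 : ℤ) ^ (m + 1) ∣ a + 1 → ¬ (2 : ℤ) ^ (m + 2) ∣ a + 1 →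
      ZMod.castHom hM (ZMod (2 ^ (m + 2))) (a : ZMod (2 ^ (m + t + 3))) =
        (((2 : ℤ) ^ (m + 1) - 1 : ℤ) : ZMod (2 ^ (m + 2))) := by
    intro a h1 h2
    rw [map_intCast]
    exact intCast_eq_of_pow_dvd_dy h1 h2
  have hr : (((2 : ℤ) ^ (m + 1) - 1 : ℤ) : ZMod (2 ^ (m + 2))) + (((2 : ℤ) ^ (m + 1) - 1 : ℤ) : ZMod (2 ^ (m + 2))) ≠ 0 := by
    intro e
    have e' : ((2 * (2 ^ (m + 1) - 1) : ℤ) : ZMod (2 ^ (m + 2))) = 0 := by push_cast at e ⊢; linear_combination e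
    rw [ZMod.intCast_zmod_eq_zero_iff_dvd] at e'
    push_cast at e'
    have h2' : (2 : ℤ) ^ (m + 2) ∣ 2 := by
      have := dvd_sub (dvd_refl ((2 : ℤ) ^ (m + 2))) e'
      rwa [show (2 : ℤ) ^ (m + 2) - 2 * (2 ^ (m + 1) - 1) = 2 by ring] at this
    exact pow_not_dvd_two (by omega) h2'
  have hrh : (((2 : ℤ) ^ (m + 1) - 1 : ℤ) : ZMod (2 ^ (m + 2))) + (((2 : ℤ) ^ (m + 1) - 1 : ℤ) : ZMod (2 ^ (m + 2))) +
      ZMod.castHom hM (ZMod (2 ^ (m + 2))) ((((2 : ℤ) ^ (t + 2) : ℤ) : ZMod (2 ^ (m + t + 3)))) ≠ 0 := by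
    intro e
    rw [map_intCast] at e
    have e' : ((2 * (2 ^ (m + 1) - 1) + 2 ^ (t + 2) : ℤ) : ZMod (2 ^ (m + 2))) = 0 := by
      push_cast at e ⊢; linear_combination e
    rw [ZMod.intCast_zmod_eq_zero_iff_dvd] at e'
    push_cast at e'
    have h2' : (4 : ℤ) ∣ 2 := by
      have h4a : (4 : ℤ) ∣ 2 * (2 ^ (m + 1) - 1) + 2 ^ (t + 2) := (four_dvd_pow (by omega)).trans e'
      have h4b : (4 : ℤ) ∣ (2 : ℤ) ^ (m + 2) + 2 ^ (t + 2) := dvd_add (four_dvd_pow (by omega)) (four_dvd_pow (by omega))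
      have := dvd_sub h4b h4a
      rwa [show (2 : ℤ) ^ (m + 2) + 2 ^ (t + 2) - (2 * (2 ^ (m + 1) - 1) + 2 ^ (t + 2)) = 2 by ring] at this
    omega
  have hh0 : ((((2 : ℤ) ^ (t + 2) : ℤ) : ZMod (2 ^ (m + t + 3)))) ≠ 0 := by
    intro e
    have e' : (((2 ^ (t + 2) : ℕ) : ℤ) : ZMod (2 ^ (m + t + 3))) = 0 := by exact_mod_cast e
    rw [ZMod.intCast_zmod_eq_zero_iff_dvd, Int.natCast_dvd_natCast, Nat.pow_dvd_pow_iff_le_right one_lt_two] at e'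
    omega
  have key := eq_or_eq_of_signedIndicator_pair_eq_dyadic hM (cls ha₁d ha₁n) (cls hb₁d hb₁n) (cls ha₂d ha₂n)
    (cls hb₂d hb₂n) hr hrh hh0 hind'
  -- back to congruences mod `q = 2q₀`
  have lift : ∀ {x y : ℤ}, (x : ZMod (2 ^ (m + t + 3))) = (y : ZMod (2 ^ (m + t + 3))) →
      ∃ w : ℤ, y - x = 2 ^ (m + t + 3) * w := by
    intro x y e
    obtain ⟨w, hw⟩ := (ZMod.intCast_eq_intCast_iff_dvd_sub _ _ _).mp e
    exact ⟨w, by rw [hw]; push_cast; ring⟩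
  obtain ⟨v₁, hv₁⟩ := hu₁
  obtain ⟨v₂, hv₂⟩ := hu₂
  push_cast at hv₁ hv₂ ⊢
  rcases key with e | e | e | e | ⟨e1, e2⟩
  · obtain ⟨w, hw⟩ := lift e
    exact Or.inl ⟨-w, by linear_combination ha₁ - ha₂ - 2 * hw⟩
  · obtain ⟨w, hw⟩ := lift e
    exact Or.inr ⟨v₂ - p₂ * w, by linear_combination hv₂ - 2 * p₂ * hw - p₂ * hb₂ + p₂ * ha₁⟩
  · obtain ⟨w, hw⟩ := lift e
    exact Or.inr ⟨v₁ + p₁ * w, by linear_combination hv₁ + 2 * p₁ * hw + p₁ * ha₂ - p₁ * hb₁⟩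
  · obtain ⟨w, hw⟩ := lift e
    exact Or.inl ⟨p₁ * p₂ * w - p₁ * v₂ + p₂ * v₁, by
      linear_combination p₁ * p₂ * hb₂ - p₁ * p₂ * hb₁ + 2 * p₁ * p₂ * hw - p₁ * hv₂ + p₂ * hv₁⟩
  · -- the residual configuration `a₁ = b₁ + h`, `b₁ = a₁ + h`: `2h = 0`, so `μ = 2`
    have h2h : (((2 ^ (t + 3) : ℕ) : ℤ) : ZMod (2 ^ (m + t + 3))) = 0 := by
      have : (a₁ : ZMod (2 ^ (m + t + 3))) = (a₁ : ZMod (2 ^ (m + t + 3))) +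
          (((2 : ℤ) ^ (t + 2) : ℤ) : ZMod (2 ^ (m + t + 3))) + (((2 : ℤ) ^ (t + 2) : ℤ) : ZMod (2 ^ (m + t + 3))) := by
        nth_rw 1 [e1]; rw [e2]
      push_cast at this ⊢
      linear_combination -this
    rw [ZMod.intCast_zmod_eq_zero_iff_dvd, Int.natCast_dvd_natCast, Nat.pow_dvd_pow_iff_le_right one_lt_two] at h2h
    obtain rfl : m = 0 := by omega
    -- `p₁* ≡ p₁ + 2^{ν−1} (mod 2^ν)`
    have e2' : (b₁ : ZMod (2 ^ (0 + t + 3))) = ((a₁ + 2 ^ (t + 2) : ℤ) : ZMod (2 ^ (0 + t + 3))) := by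
      push_cast at e2 ⊢; exact e2
    obtain ⟨w, hw⟩ := lift e2'.symm
    -- `p₁ + 1 = 4c₁`, `c₁` odd
    obtain ⟨s₁, hs₁⟩ := hμd
    obtain ⟨s₂, hs₂⟩ := hμd₂
    have hso₁ : Odd s₁ := by
      rw [← Int.not_even_iff_odd]; rintro ⟨x, rfl⟩; exact hμn ⟨x, by rw [hs₁]; ring⟩
    have hso₂ : Odd s₂ := by
      rw [← Int.not_even_iff_odd]; rintro ⟨x, rfl⟩; exact hμn₂ ⟨x, by rw [hs₂]; ring⟩
    rcases Nat.eq_zero_or_pos t with rfl | ht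
    · -- `ν = 4`, `q = 16`: `p₁, p₂ ∈ {3, 11}`
      have h16 := sixteen_dvd_dy (p₁ := p₁) (p₂ := p₂) (c₁ := s₁) (c₂ := s₂) (by linear_combination hs₁)
        (by linear_combination hs₂) hso₁ hso₂
      norm_num
      exact h16
    · -- `ν ≥ 5`: `p₁² + 2^{ν−1}p₁ ≡ 1 (mod 2^ν)` is impossible modulo `16` for `p₁ ≡ 3 (mod 8)`
      exfalso
      obtain ⟨t', rfl⟩ : ∃ t', t = t' + 1 := ⟨t - 1, by omega⟩
      obtain ⟨i, hi⟩ := hso₁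
      have hp₁ : p₁ = 8 * i + 3 := by linear_combination hs₁ + 4 * hi
      have hu₁' : u₁ = p₁ + 2 ^ (t' + 4) + 2 ^ (t' + 5) * w := by
        linear_combination hb₁ - ha₁ + 2 * hw
      have h16 : (16 : ℤ) ∣ 8 := ⟨2 ^ (t' + 1) * v₁ - 4 * i ^ 2 - 3 * i - (8 * i + 3) * 2 ^ t' -
          (8 * i + 3) * 2 ^ (t' + 1) * w, by
        rw [hu₁', hp₁] at hv₁
        linear_combination hv₁⟩
      omega

/-- **THE MAIN THEOREM (Ikeda–Yamamoto 1979) for `q = 2^ν`, normalized weights.** Let `p₁, p₂` be prime to `q = 2^ν`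
(`ν ≥ 0`). If the three-dimensional lens spaces `L(q; 1, p₁)` and `L(q; 1, p₂)` are isospectral (`dim E_{n(n+2)}` agree for
all `n`) then `p₁ ≡ ±p₂` or `p₁p₂ ≡ ±1 (mod q)` — (4.1)/(4.2) of Proposition 4.1: the two lens spaces are isometric. Cases:
`ν ≤ 3` is Lemma 6.1 (the tree's `dvd_of_lensMultiplicity_eq_of_dvd_eight`, row g45-#7); for `ν ≥ 4` ("by Lemma 6.1, we may
assume `ν ≥ 4`") the homogeneous case `p₁ ≡ ±1` is Corollary 3.4 of the tree; otherwise "either `p₁ + 1` or `p₁ − 1` is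
divisible by `2²`" and, replacing `p₁`, `p₂` by `±p₁`, `±p₂` (isometric spaces, same multiplicities; Lemma 4.4 with `d = 4`
for `p₂`), `4 ∣ pᵢ + 1` — `dvd_of_lensMultiplicity_one_eq_of_two_pow_of_four_dvd`. [cite: IkedaYamamoto1979, Main Theorem
(`q = 2^ν`), §9, Lemma 6.1, Lemma 4.4, Corollary 3.4, Proposition 4.1] -/
theorem dvd_of_lensMultiplicity_one_eq_of_two_pow {q ν : ℕ} (hq : q = 2 ^ ν) {p₁ p₂ : ℤ} (hp₁ : IsCoprime p₁ q)
    (hp₂ : IsCoprime p₂ q) (h : ∀ n : ℕ, lensMultiplicity q 1 p₁ n = lensMultiplicity q 1 p₂ n) :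
    (q : ℤ) ∣ p₁ - p₂ ∨ (q : ℤ) ∣ p₁ + p₂ ∨ (q : ℤ) ∣ p₁ * p₂ - 1 ∨ (q : ℤ) ∣ p₁ * p₂ + 1 := by
  have hq0 : q ≠ 0 := by rw [hq]; positivity
  haveI : NeZero q := ⟨hq0⟩
  have h1cop : IsCoprime (1 : ℤ) q := isCoprime_one_left
  -- `ν ≤ 3`: Lemma 6.1
  by_cases hν : ν ≤ 3
  · have h8 : q ∣ 8 := by rw [hq, show (8 : ℕ) = 2 ^ 3 by norm_num]; exact Nat.pow_dvd_pow 2 hν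
    rcases dvd_of_lensMultiplicity_eq_of_dvd_eight h8 h1cop hp₁ h1cop hp₂ h with ⟨c, hc⟩ | ⟨c, hc⟩ | ⟨c, hc⟩ | ⟨c, hc⟩
    · exact Or.inl ⟨-c, by linear_combination -hc⟩
    · exact Or.inr (Or.inl ⟨c, by linear_combination hc⟩)
    · exact Or.inr (Or.inr (Or.inl ⟨-c, by linear_combination -hc⟩))
    · exact Or.inr (Or.inr (Or.inr ⟨c, by linear_combination hc⟩))
  have hν4 : 4 ≤ ν := by omega
  have hqz : (q : ℤ) = 2 ^ ν := by rw [hq]; push_cast; ring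
  have h4q : (4 : ℤ) ∣ (q : ℤ) := by
    rw [hqz, show (4 : ℤ) = 2 ^ 2 by norm_num]; exact pow_dvd_pow 2 (by omega)
  have h42 : ¬ (4 : ℤ) ∣ 2 := by omega
  -- weights prime to `2^ν` are odd: `4 ∣ p + 1` or `4 ∣ p − 1`
  have four_dvd : ∀ {p : ℤ}, IsCoprime p q → (4 : ℤ) ∣ p + 1 ∨ (4 : ℤ) ∣ p - 1 := by
    intro p hp
    obtain ⟨a, b, hab⟩ := hp
    obtain ⟨c, hc⟩ : (2 : ℤ) ∣ (q : ℤ) := by rw [hqz]; exact dvd_pow_self 2 (by omega)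
    rw [hc] at hab
    have hodd : ¬ (2 : ℤ) ∣ p := by
      rintro ⟨d, rfl⟩
      have : (2 : ℤ) ∣ 1 := ⟨a * d + b * c, by linear_combination -hab⟩
      omega
    omega
  -- the homogeneous case: COROLLARY 3.4
  have hom : ∀ {a b : ℤ}, IsCoprime b q → (∀ n : ℕ, lensMultiplicity q 1 a n = lensMultiplicity q 1 b n) →
      ((q : ℤ) ∣ a - 1 ∨ (q : ℤ) ∣ a + 1) → (q : ℤ) ∣ a - b ∨ (q : ℤ) ∣ a + b := by
    intro a b hb hab hhom
    have hhom' : (q : ℤ) ∣ 1 - a ∨ (q : ℤ) ∣ 1 + a := by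
      rcases hhom with hh | hh
      · exact Or.inl (by rw [← dvd_neg, neg_sub]; exact hh)
      · exact Or.inr (by rwa [add_comm])
    rcases dvd_sub_or_dvd_add_of_lensMultiplicity_eq q h1cop h1cop hb hhom' hab with hb' | hb'
    · rcases hhom with hh | hh
      · left; have := dvd_add hh hb'; rwa [show a - 1 + (1 - b) = a - b by ring] at this
      · right; have := dvd_sub hh hb'; rwa [show a + 1 - (1 - b) = a + b by ring] at this
    · rcases hhom with hh | hh
      · right; have := dvd_add hh hb'; rwa [show a - 1 + (1 + b) = a + b by ring] at this
      · left; have := dvd_sub hh hb'; rwa [show a + 1 - (1 + b) = a - b by ring] at this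
  -- §9 for a pair `(a, b)` with `4 ∣ a + 1`: `a ≡ ±b` or `ab ≡ ±1`
  have ninth : ∀ {a b : ℤ}, IsCoprime a q → IsCoprime b q → (4 : ℤ) ∣ a + 1 →
      (∀ n : ℕ, lensMultiplicity q 1 a n = lensMultiplicity q 1 b n) →
      (q : ℤ) ∣ a - b ∨ (q : ℤ) ∣ a + b ∨ (q : ℤ) ∣ a * b - 1 ∨ (q : ℤ) ∣ a * b + 1 := by
    intro a b ha hb h4a hab
    by_cases hqa : (q : ℤ) ∣ a + 1
    · rcases hom hb hab (Or.inr hqa) with h' | h'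
      · exact Or.inl h'
      · exact Or.inr (Or.inl h')
    obtain ⟨ua, ba, huba⟩ := ha
    obtain ⟨ub, bb, hubb⟩ := hb
    have hua : (q : ℤ) ∣ ua * a - 1 := ⟨-ba, by linear_combination huba⟩
    have hub : (q : ℤ) ∣ ub * b - 1 := ⟨-bb, by linear_combination hubb⟩
    have hub' : (q : ℤ) ∣ (-ub) * (-b) - 1 := by rw [neg_mul_neg]; exact hub
    -- Lemma 4.4 with `d = 4`: `4 ∣ b + 1` or `4 ∣ b − 1`; in the second case pass to `−b`
    rcases dvd_or_dvd_of_dvd_of_lensMultiplicity_eq hua hub hab h4q h42 (Or.inl h4a) with h4b | h4b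
    · rcases dvd_of_lensMultiplicity_one_eq_of_two_pow_of_four_dvd hq hν4 hua hub h4a h4b hqa hab with h' | h'
      · exact Or.inl h'
      · exact Or.inr (Or.inr (Or.inl h'))
    · have h4b' : (4 : ℤ) ∣ -b + 1 := by rw [show -b + 1 = -(b - 1) by ring, dvd_neg]; exact h4b
      have hab' : ∀ n : ℕ, lensMultiplicity q 1 a n = lensMultiplicity q 1 (-b) n := fun n ↦ by
        rw [lensMultiplicity_neg_right, hab n]
      rcases dvd_of_lensMultiplicity_one_eq_of_two_pow_of_four_dvd hq hν4 hua hub' h4a h4b' hqa hab' with h' | h'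
      · exact Or.inr (Or.inl (by rw [show a + b = a - -b by ring]; exact h'))
      · exact Or.inr (Or.inr (Or.inr (by rw [show a * b + 1 = -(a * -b - 1) by ring, dvd_neg]; exact h')))
  -- dispatch on `p₁ mod 4`
  rcases four_dvd hp₁ with hA | hB
  · exact ninth hp₁ hp₂ hA h
  · have hB' : (4 : ℤ) ∣ -p₁ + 1 := by rw [show -p₁ + 1 = -(p₁ - 1) by ring, dvd_neg]; exact hB
    have h' : ∀ n : ℕ, lensMultiplicity q 1 (-p₁) n = lensMultiplicity q 1 p₂ n := fun n ↦ by
      rw [lensMultiplicity_neg_right, h n]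
    rcases ninth hp₁.neg_left hp₂ hB' h' with h' | h' | h' | h'
    · exact Or.inr (Or.inl (by rw [show p₁ + p₂ = -(-p₁ - p₂) by ring, dvd_neg]; exact h'))
    · exact Or.inl (by rw [show p₁ - p₂ = -(-p₁ + p₂) by ring, dvd_neg]; exact h')
    · exact Or.inr (Or.inr (Or.inr (by rw [show p₁ * p₂ + 1 = -(-p₁ * p₂ - 1) by ring, dvd_neg]; exact h')))
    · exact Or.inr (Or.inr (Or.inl (by rw [show p₁ * p₂ - 1 = -(-p₁ * p₂ + 1) by ring, dvd_neg]; exact h')))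

/-- **THE MAIN THEOREM (Ikeda–Yamamoto 1979) for `q = 2^ν`, general weights.** Let `q = 2^ν` and `p₁, p₂, p₁', p₂'` prime to
`q`. If `L(q; p₁, p₂)` and `L(q; p₁', p₂')` are isospectral then `p₁p₂' ≡ ±p₁'p₂` or `p₁p₁' ≡ ±p₂p₂' (mod q)`: the two lens
spaces are isometric (Proposition 1.1; reduction to the normalized form via `L(q; p₁, p₂) ≅ L(q; 1, p₁*p₂)`, the tree's
`lensMultiplicity_eq_one_left`). [cite: IkedaYamamoto1979, Main Theorem (`q = 2^ν`), §4 ("we may assume `p₀ = 1`"),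
Proposition 1.1] -/
theorem dvd_of_lensMultiplicity_eq_of_two_pow {q ν : ℕ} (hq : q = 2 ^ ν) {p₁ p₂ p₁' p₂' : ℤ} (hp₁ : IsCoprime p₁ q)
    (hp₂ : IsCoprime p₂ q) (hp₁' : IsCoprime p₁' q) (hp₂' : IsCoprime p₂' q)
    (h : ∀ n : ℕ, lensMultiplicity q p₁ p₂ n = lensMultiplicity q p₁' p₂' n) :
    (q : ℤ) ∣ p₁ * p₂' - p₁' * p₂ ∨ (q : ℤ) ∣ p₁ * p₂' + p₁' * p₂ ∨
      (q : ℤ) ∣ p₁ * p₁' - p₂ * p₂' ∨ (q : ℤ) ∣ p₁ * p₁' + p₂ * p₂' := by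
  obtain ⟨u₁, b₁, hub₁⟩ := hp₁
  obtain ⟨u₁', b₁', hub₁'⟩ := hp₁'
  have hu₁ : (q : ℤ) ∣ u₁ * p₁ - 1 := ⟨-b₁, by linear_combination hub₁⟩
  have hu₁' : (q : ℤ) ∣ u₁' * p₁' - 1 := ⟨-b₁', by linear_combination hub₁'⟩
  have hcu₁ : IsCoprime u₁ q := ⟨p₁, b₁, by linear_combination hub₁⟩
  have hcu₁' : IsCoprime u₁' q := ⟨p₁', b₁', by linear_combination hub₁'⟩
  have hred : ∀ n : ℕ, lensMultiplicity q 1 (u₁ * p₂) n = lensMultiplicity q 1 (u₁' * p₂') n := fun n ↦ by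
    rw [← lensMultiplicity_eq_one_left q hu₁ p₂ n, h n, lensMultiplicity_eq_one_left q hu₁' p₂' n]
  have key := dvd_of_lensMultiplicity_one_eq_of_two_pow hq (hcu₁.mul_left hp₂) (hcu₁'.mul_left hp₂') hred
  have eU := cast_mul_cast_eq_one_dy hu₁
  have eU' := cast_mul_cast_eq_one_dy hu₁'
  have cast0 : ∀ {t : ℤ}, (q : ℤ) ∣ t → (t : ZMod q) = 0 := fun ht ↦ (ZMod.intCast_zmod_eq_zero_iff_dvd _ _).mpr ht
  rcases key with e | e | e | e
  · have e' := cast0 e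
    push_cast at e'
    refine Or.inl ((ZMod.intCast_zmod_eq_zero_iff_dvd _ _).mp ?_)
    push_cast
    linear_combination (-((p₁ : ZMod q) * (p₁' : ZMod q))) * e' + ((p₁' : ZMod q) * (p₂ : ZMod q)) * eU -
      ((p₁ : ZMod q) * (p₂' : ZMod q)) * eU'
  · have e' := cast0 e
    push_cast at e'
    refine Or.inr (Or.inl ((ZMod.intCast_zmod_eq_zero_iff_dvd _ _).mp ?_))
    push_cast
    linear_combination ((p₁ : ZMod q) * (p₁' : ZMod q)) * e' - ((p₁' : ZMod q) * (p₂ : ZMod q)) * eU -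
      ((p₁ : ZMod q) * (p₂' : ZMod q)) * eU'
  · have e' := cast0 e
    push_cast at e'
    refine Or.inr (Or.inr (Or.inl ((ZMod.intCast_zmod_eq_zero_iff_dvd _ _).mp ?_)))
    push_cast
    linear_combination (-((p₁ : ZMod q) * (p₁' : ZMod q))) * e' +
      ((p₂ : ZMod q) * (p₂' : ZMod q) * (u₁' : ZMod q) * (p₁' : ZMod q)) * eU + ((p₂ : ZMod q) * (p₂' : ZMod q)) * eU'
  · have e' := cast0 e
    push_cast at e'
    refine Or.inr (Or.inr (Or.inr ((ZMod.intCast_zmod_eq_zero_iff_dvd _ _).mp ?_)))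
    push_cast
    linear_combination ((p₁ : ZMod q) * (p₁' : ZMod q)) * e' -
      ((p₂ : ZMod q) * (p₂' : ZMod q) * (u₁' : ZMod q) * (p₁' : ZMod q)) * eU - ((p₂ : ZMod q) * (p₂' : ZMod q)) * eU'

/-- **ISOSPECTRAL ⟺ ISOMETRIC for three-dimensional lens spaces with fundamental group of order `q = 2^ν`** (the Main
Theorem of Ikeda–Yamamoto for `q = 2^ν`, packaged with its easy converse): for weights prime to `q`, the lens spaces
`L(q; p₁, p₂)` and `L(q; p₁', p₂')` have the same multiplicities `dim E_{n(n+2)}` for all `n` iff they satisfy Ikeda's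
isometry criterion `LensWeightsEquivalent` ((4.1)/(4.2), Proposition 1.1); the converse direction is the tree's
`LensWeightsEquivalent.lensSpaceMultiplicity_eq`. [cite: IkedaYamamoto1979, Main Theorem and the Theorem of the
Introduction (`q = 2^ν`), Proposition 1.1, Proposition 4.1] [cite: Ikeda1980, Theorem 2.1] -/
theorem lensMultiplicity_eq_iff_lensWeightsEquivalent_of_two_pow {q ν : ℕ} (hq : q = 2 ^ ν) {p₁ p₂ p₁' p₂' : ℤ}
    (hp₁ : IsCoprime p₁ q) (hp₂ : IsCoprime p₂ q) (hp₁' : IsCoprime p₁' q) (hp₂' : IsCoprime p₂' q) :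
    (∀ n : ℕ, lensMultiplicity q p₁ p₂ n = lensMultiplicity q p₁' p₂' n) ↔ LensWeightsEquivalent q ![p₁, p₂] ![p₁', p₂'] := by
  have hq0 : q ≠ 0 := by rw [hq]; positivity
  constructor
  · intro h
    exact (lensWeightsEquivalent_two_iff hp₁').mpr (dvd_of_lensMultiplicity_eq_of_two_pow hq hp₁ hp₂ hp₁' hp₂' h)
  · intro hE n
    have hc : ∀ i : Fin 2, IsCoprime (![p₁, p₂] i) q := fun i ↦ by
      fin_cases i
      · simpa using hp₁
      · simpa using hp₂
    have := LensWeightsEquivalent.lensSpaceMultiplicity_eq (q := q) hq0 hE hc n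
    rwa [lensSpaceMultiplicity_two, lensSpaceMultiplicity_two] at this

/-- **THE MAIN THEOREM OF IKEDA–YAMAMOTO 1979 AS PROVED THERE** ("This theorem will be shown here in this paper only for
`q = l^ν`, `2l^ν` and `2^ν` where `l` is an odd prime and `ν ≥ 1`"): if `q` is a prime power `l^ν` (`l` any prime, `ν ≥ 1`)
or twice an odd prime power `2l^ν`, then for weights prime to `q` the three-dimensional lens spaces `L(q; p₁, p₂)` and
`L(q; p₁', p₂')` are isospectral if and only if they are isometric (Ikeda's criterion `LensWeightsEquivalent`):
`q = 2^ν` by `lensMultiplicity_eq_iff_lensWeightsEquivalent_of_two_pow`, `q ∈ {l^ν, 2l^ν}` for odd `l` by row g45-#7's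
`lensMultiplicity_eq_iff_lensWeightsEquivalent_of_prime_pow_or_twice`. [cite: IkedaYamamoto1979, Main Theorem,
Introduction] [cite: Ikeda1980, Theorem 2.1] -/
theorem lensMultiplicity_eq_iff_lensWeightsEquivalent_of_prime_pow_or_twice_odd {q l ν : ℕ} (hl : l.Prime) (hν : ν ≠ 0)
    (hq : q = l ^ ν ∨ (l ≠ 2 ∧ q = 2 * l ^ ν)) {p₁ p₂ p₁' p₂' : ℤ} (hp₁ : IsCoprime p₁ q) (hp₂ : IsCoprime p₂ q)
    (hp₁' : IsCoprime p₁' q) (hp₂' : IsCoprime p₂' q) :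
    (∀ n : ℕ, lensMultiplicity q p₁ p₂ n = lensMultiplicity q p₁' p₂' n) ↔ LensWeightsEquivalent q ![p₁, p₂] ![p₁', p₂'] := by
  rcases hq with hq | ⟨hl2, hq⟩
  · by_cases hl2 : l = 2
    · subst hl2
      exact lensMultiplicity_eq_iff_lensWeightsEquivalent_of_two_pow hq hp₁ hp₂ hp₁' hp₂'
    · exact lensMultiplicity_eq_iff_lensWeightsEquivalent_of_prime_pow_or_twice (Or.inl hq) hl hl2 hν hp₁ hp₂ hp₁' hp₂'
  · exact lensMultiplicity_eq_iff_lensWeightsEquivalent_of_prime_pow_or_twice (Or.inr hq) hl hl2 hν hp₁ hp₂ hp₁' hp₂'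

end Literature.Analysis.InnerProduct
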